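import Literature.Barriers.PneNP.NegationLimitedGapProofs
import HarnessLib

/-!
# Route NegLimited, rung T4 (stmt-PneNP-19862) — the ⊕-halving lemma

Single-output analogue of Jukna 2012, Claim 10.22 (PDF pp. 310–311), for the PARITY fold instead
of the `k`-fold (multi-output) extension: if a straight-line program over `{∧₂, ∨₂, ¬}` with at
most `r` NOT gates computes the parity `⊕_{j<k} f(x_{j,·})` of `k ≥ 2^r` disjoint copies of a
non-constant monotone `f`, then `f` has a `{∧₂, ∨₂}`-program with no more gates
(`parityFold_induction`, `circuitSizeOver_le_of_computes_parityFold`).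

Proof (cell record HOME/pnp-ideate-p3/ROUND-4.md §7.5, invariant `J(r)`): the halving step is the
tree's `Literature.Barriers.PneNP.claim_10_22_induction` verbatim — the first NOT gate reads a
monotone `g`; with `z` the box input that is `0` on one half `L₁` of the live blocks and `1` on the
other, if `g z = 1` freeze the other half to `1` (then `g ≡ 1` on the smaller box), else freeze `L₁`
to `0` (`g ≡ 0`); the NOT gate becomes a constant gate (`GateList.vals_replace_eq`). Only the
invariant differs: the single output wire computes the parity fold on the box (dead blocks frozen
to constants contribute a constant to the parity). End (`d = 0`): substitute the constants and
identify one live block with the variables of `f` (`GateList.substElim_wire`); the output wire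
then carries `f ⊕ s` for a constant `s`; `s = 1` is impossible because a `{∧₂, ∨₂}`-program
computes a monotone function (`GateList.monotone_wireOf_vals`) while `¬ f` is antitone and not
constant.

References: S. Jukna, *Boolean Function Complexity* (2012), §10.5, Claim 10.22 (PDF pp. 310–311)
[Jukna2012]; S. C. Sung, K. Tanaka, *Lower bounds on negation-limited inverters*, RIMS Kôkyûroku
992 (1997), §3 (the ⊕ device for two outputs).
-/

set_option linter.dupNamespace false

noncomputable section

namespace Summit.PneNP.PneNP.Theorems.NegLimNearMarkov

open Finset Literature.Computability.Complexity Literature.Computability.Complexity.GateList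
  Literature.Barriers.PneNP Literature.Barriers.PneNP.GateList

/-! ## The parity fold -/

/-- The **`k`-fold parity extension** of `f : {0,1}^m → {0,1}`: the XOR of `k` copies of `f` on
disjoint blocks of variables, `⊕_{j<k} f(x_{j,·})` (as the parity of the number of accepting
blocks). [folklore] -/
def parityFold (k m : ℕ) (f : (Fin m → Bool) → Bool) (x : Fin k × Fin m → Bool) : Bool :=
  Nat.bodd #(univ.filter fun j : Fin k => f (fun i => x (j, i)) = true)

/-- Unfolding `parityFold`. [folklore] -/
theorem parityFold_apply (k m : ℕ) (f : (Fin m → Bool) → Bool) (x : Fin k × Fin m → Bool) :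
    parityFold k m f x = Nat.bodd #(univ.filter fun j : Fin k => f (fun i => x (j, i)) = true) :=
  rfl

/-- The parity fold on an input whose blocks other than `j₀` are frozen to the constants `c j`
is `f` of block `j₀`, XOR the (constant) parity of the frozen blocks. [folklore] -/
theorem parityFold_update {k m : ℕ} (f : (Fin m → Bool) → Bool) (j₀ : Fin k) (c : Fin k → Bool)
    (y : Fin m → Bool) :
    parityFold k m f (fun p => if p.1 = j₀ then y p.2 else c p.1) =
      ((f y).xor (Nat.bodd #((univ.erase j₀).filter fun j : Fin k => f (fun _ => c j) = true))) := by
  rw [parityFold_apply, ← Finset.insert_erase (Finset.mem_univ j₀), Finset.filter_insert]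
  have hrest : (univ.erase j₀).filter (fun j : Fin k =>
      f (fun i => if ((j, i) : Fin k × Fin m).1 = j₀ then y ((j, i) : Fin k × Fin m).2
        else c ((j, i) : Fin k × Fin m).1) = true) =
      (univ.erase j₀).filter fun j : Fin k => f (fun _ => c j) = true := by
    refine Finset.filter_congr fun j hj => ?_
    have hne : j ≠ j₀ := (Finset.mem_erase.1 hj).1
    simp [hne]
  rw [hrest]
  simp only [↓reduceIte]
  by_cases hfy : f y = true
  · rw [if_pos hfy, Finset.card_insert_of_notMem (fun h => by simp at h), Nat.bodd_succ, hfy]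
    simp
  · rw [if_neg hfy]
    simp only [Bool.not_eq_true] at hfy
    rw [hfy]
    simp

/-- A monotone non-constant Boolean function is `false` at the bottom and `true` at the top.
[folklore] -/
theorem eq_false_bot_and_eq_true_top {m : ℕ} {f : (Fin m → Bool) → Bool} (hf : Monotone f)
    (hnc : ∃ x y, f x ≠ f y) : f (fun _ => false) = false ∧ f (fun _ => true) = true := by
  obtain ⟨x, y, hxy⟩ := hnc
  have hbx : f (fun _ => false) ≤ f x := hf fun _ => Bool.false_le _
  have hby : f (fun _ => false) ≤ f y := hf fun _ => Bool.false_le _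
  have htx : f x ≤ f (fun _ => true) := hf fun _ => Bool.le_true _
  have hty : f y ≤ f (fun _ => true) := hf fun _ => Bool.le_true _
  revert hbx hby htx hty hxy
  cases f (fun _ => false) <;> cases f (fun _ => true) <;> cases f x <;> cases f y <;> simp

/-- No monotone function is the negation of a monotone non-constant function. [folklore] -/
theorem not_monotone_not_comp {m : ℕ} {f : (Fin m → Bool) → Bool} (hf : Monotone f)
    (hnc : ∃ x y, f x ≠ f y) {h : (Fin m → Bool) → Bool} (hh : Monotone h)
    (hfh : ∀ y, h y = !(f y)) : False := by
  obtain ⟨h0, h1⟩ := eq_false_bot_and_eq_true_top hf hnc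
  have := hh (show (fun _ : Fin m => false) ≤ fun _ => true from fun _ => Bool.false_le _)
  rw [hfh, hfh, h0, h1] at this
  exact absurd this (by decide)

/-! ## The induction -/

/-- **The ⊕-halving induction** (⊕-variant of Jukna 2012, Claim 10.22, iterated). Data: a set
`live` of at least `2^d` live blocks, constants `c j` frozen on the dead blocks, and a program `P`
over `{∧₂, ∨₂, ¬, 0, 1}` with at most `d` NOT gates whose wire `out` computes the parity fold
`⊕_j f(x_{j,·})` on every input of the box `{x | x_{j,·} ≡ c j for j dead}`. Conclusion: `f` has a
`{∧₂, ∨₂}`-program with at most `P.length` gates. Step: the tree's halving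
(`claim_10_22_induction`): the first NOT gate reads a monotone `g`; freeze one half of the live
blocks so that `g` becomes constant on the smaller box and replace the NOT gate by a constant gate.
End (`d = 0`): substitute the constants, identify a live block with the variables of `f`
(`substElim_wire`); the output wire carries `f ⊕ s`, and `s = 1` contradicts monotonicity of
`{∧₂, ∨₂}`-programs. [cite: Jukna2012, Claim 10.22 (PDF pp. 310–311)] -/
theorem parityFold_induction {k m : ℕ} {f : (Fin m → Bool) → Bool} (hf : Monotone f)
    (hnc : ∃ x y, f x ≠ f y) {L : ℕ} (out : (Fin k × Fin m) ⊕ ℕ) (hout : OutOK L out) :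
    ∀ (d : ℕ) (live : Finset (Fin k)) (c : Fin k → Bool) (P : List (Gate (Fin k × Fin m))),
      2 ^ d ≤ #live → WF P → (∀ g ∈ P, g.fn ∈ deMorganBasis01) → P.length = L → negs P ≤ d →
      (∀ x : Fin k × Fin m → Bool, (∀ j ∉ live, ∀ i, x (j, i) = c j) →
        wireOf x (vals P x) out = parityFold k m f x) →
      CktSize monotoneBasis (fun (y : Fin m → Bool) (_ : Unit) => f y) L
  | 0, live, c, P, hcard, hwf, hB, hlen, hnegs, hbox => by
    obtain ⟨j₀, hj₀⟩ : live.Nonempty := Finset.card_pos.1 (by simpa using hcard)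
    have hB01 : ∀ g ∈ P, g.fn ∈ monotoneBasis01 := fun g hg =>
      mem_monotoneBasis01_of_ne_not (hB g hg) fun hnot => by
        obtain ⟨pre, post, rfl⟩ := List.append_of_mem hg
        have : negs (pre ++ g :: post) = negs pre + (1 + negs post) := by simp [hnot]
        omega
    -- substitute the constants, identify block `j₀` with the variables of `f`
    let σ : Fin k × Fin m → Bool ⊕ Fin m := fun p => if p.1 = j₀ then .inr p.2 else .inl (c p.1)
    obtain ⟨ns, hwf', hB', hlen', hτ⟩ := substElim_wire σ P hwf hB01
    have hLift : ∀ (y : Fin m → Bool) (p : Fin k × Fin m),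
        Sum.elim (fun b => b) y (σ p) = if p.1 = j₀ then y p.2 else c p.1 := by
      intro y p
      by_cases hp : p.1 = j₀ <;> simp [σ, hp]
    -- the constant parity of the frozen blocks
    set s : Bool := Nat.bodd #((univ.erase j₀).filter fun j : Fin k => f (fun _ => c j) = true)
      with hs
    have hbox' : ∀ y : Fin m → Bool,
        wireOf (fun p => Sum.elim (fun b => b) y (σ p))
          (vals P fun p => Sum.elim (fun b => b) y (σ p)) out = ((f y).xor s) := by
      intro y
      simp only [hLift]
      have h := hbox (fun p => if p.1 = j₀ then y p.2 else c p.1) (fun j hj i => by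
        have hne : j ≠ j₀ := fun h => hj (h ▸ hj₀)
        simp [hne])
      rw [h, parityFold_update]
    obtain ⟨τ, hτ₀⟩ := hτ out (fun m' hm => hlen ▸ hout m' hm)
    rcases τ with b | w
    · -- the output cannot be a constant: `f` is not constant
      exfalso
      obtain ⟨x, y, hxy⟩ := hnc
      have hx : ((f x).xor s) = b := (hbox' x).symm.trans (hτ₀ x)
      have hy : ((f y).xor s) = b := (hbox' y).symm.trans (hτ₀ y)
      apply hxy
      revert hx hy
      cases f x <;> cases f y <;> cases s <;> cases b <;> simp
    · obtain ⟨hw, hfw⟩ := hτ₀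
      cases hsb : s with
      | false =>
        refine ⟨ns, fun _ => w, hlen'.trans hlen.le,
          ⟨hwf', hB', fun _ m' hm => hw m' hm, fun y _ => ?_⟩⟩
        have := (hfw y).symm.trans (hbox' y)
        rw [hsb, Bool.xor_false] at this
        exact this
      | true =>
        -- the output would carry `¬ f`, which no `{∧₂, ∨₂}`-program computes
        exfalso
        refine not_monotone_not_comp hf hnc (monotone_wireOf_vals ns hwf' hB' w hw) fun y => ?_
        have := (hfw y).symm.trans (hbox' y)
        rw [hsb, Bool.xor_true] at this
        exact this
  | d + 1, live, c, P, hcard, hwf, hB, hlen, hnegs, hbox => by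
    by_cases hle : negs P ≤ d
    · exact parityFold_induction hf hnc out hout d live c P
        ((Nat.pow_le_pow_right two_pos (Nat.le_succ d)).trans hcard) hwf hB hlen hle hbox
    obtain ⟨pre, w, post, rfl, hpre⟩ := exists_first_notGate (gs := P) (by omega)
    have hw : OutOK pre.length w := fun m' hm => hwf.gateOK_mid (0 : Fin 1) m' hm
    have hpreB : ∀ g ∈ pre, g.fn ∈ monotoneBasis01 := fun g hg =>
      mem_monotoneBasis01_of_ne_not (hB g (by simp [hg])) (hpre g hg)
    have hgmono : Monotone (fun x => wireOf x (vals pre x) w) :=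
      monotone_wireOf_vals01 pre hwf.of_append_left hpreB w hw
    -- split the live blocks into two halves
    have hd : 2 ^ d ≤ #live := (Nat.pow_le_pow_right two_pos (Nat.le_succ d)).trans hcard
    obtain ⟨L₁, hL₁, hL₁card⟩ := Finset.exists_subset_card_eq hd
    have hL₂card : 2 ^ d ≤ #(live \ L₁) := by
      rw [Finset.card_sdiff_of_subset hL₁, hL₁card]
      have : 2 ^ (d + 1) = 2 ^ d + 2 ^ d := by rw [pow_succ]; ring
      omega
    -- the test input: `0` on `L₁`, `1` on the other live blocks, the constants elsewhere
    let z : Fin k × Fin m → Bool := fun p => if p.1 ∈ live then decide (p.1 ∉ L₁) else c p.1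
    set ε := wireOf z (vals pre z) w with hε
    -- new live set and constants: freeze the blocks `live \ live'` to `ε`
    let live' : Finset (Fin k) := if ε then L₁ else live \ L₁
    let c' : Fin k → Bool := fun j => if j ∈ live ∧ j ∉ live' then ε else c j
    have hlive' : live' ⊆ live := by
      dsimp only [live']; split_ifs
      · exact hL₁
      · exact sdiff_subset
    have hcard' : 2 ^ d ≤ #live' := by
      dsimp only [live']; split_ifs
      · exact hL₁card.ge
      · exact hL₂card
    -- on the new box the argument of the NOT gate is the constant `ε`
    have hgε : ∀ x : Fin k × Fin m → Bool, (∀ j ∉ live', ∀ i, x (j, i) = c' j) →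
        wireOf x (vals pre x) w = ε := by
      intro x hx
      cases hb : ε with
      | true =>
        -- `z ≤ x`
        have hzx : z ≤ x := by
          rintro ⟨j, i⟩
          by_cases hj : j ∈ live
          · by_cases hj1 : j ∈ L₁
            · simp [z, hj, hj1]
            · have hjl : j ∉ live' := by simp [live', hb, hj1]
              have := hx j hjl i
              simp only [c', hj, hjl, not_false_eq_true, and_self, ↓reduceIte] at this
              rw [this, hb]
              exact Bool.le_true _
          · have hjl : j ∉ live' := fun h => hj (hlive' h)
            have := hx j hjl i
            simp only [c', hj, false_and, ↓reduceIte] at this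
            simp [z, hj, this]
        have h := hgmono hzx
        simp only [← hε, hb] at h
        exact Bool.eq_true_of_true_le h
      | false =>
        -- `x ≤ z`
        have hxz : x ≤ z := by
          rintro ⟨j, i⟩
          by_cases hj : j ∈ live
          · by_cases hj1 : j ∈ L₁
            · have hjl : j ∉ live' := by simp [live', hb, hj1]
              have := hx j hjl i
              simp only [c', hj, hjl, not_false_eq_true, and_self, ↓reduceIte] at this
              rw [this, hb]
              exact Bool.false_le _
            · simp [z, hj, hj1]
          · have hjl : j ∉ live' := fun h => hj (hlive' h)
            have := hx j hjl i
            simp only [c', hj, false_and, ↓reduceIte] at this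
            simp [z, hj, this]
        have h := hgmono hxz
        simp only [← hε, hb] at h
        revert h
        cases wireOf x (vals pre x) w <;> simp
    -- the program with the NOT gate frozen to `¬ε`
    have hvals : ∀ x : Fin k × Fin m → Bool, (∀ j ∉ live', ∀ i, x (j, i) = c' j) →
        vals (pre ++ constGate _ (!ε) :: post) x = vals (pre ++ notGate w :: post) x := by
      intro x hx
      refine (vals_replace_eq pre post _ _ x ?_).symm
      show (!(wireOf x (vals pre x) w)) = !ε
      rw [hgε x hx]
    refine parityFold_induction hf hnc out hout d live' c' (pre ++ constGate _ (!ε) :: post)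
      hcard' (hwf.replace (gateOK_constGate _ _)) ?_ (by simpa using hlen) ?_ ?_
    · intro g hg
      simp only [List.mem_append, List.mem_cons] at hg
      rcases hg with hg | rfl | hg
      · exact hB g (by simp [hg])
      · simpa using const_mem_deMorganBasis01 (!ε)
      · exact hB g (by simp [hg])
    · have h1 : negs (pre ++ notGate w :: post) = negs pre + (1 + negs post) := by simp
      have h2 : negs (pre ++ constGate (Fin k × Fin m) (!ε) :: post) =
          negs pre + (0 + negs post) := by
        simp
      omega
    · intro x hx
      rw [hvals x hx]
      refine hbox x (fun j' hj' i => ?_)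
      have h1 : j' ∉ live' := fun h => hj' (hlive' h)
      have := hx j' h1 i
      simp only [c', hj', false_and, ↓reduceIte] at this
      exact this

/-! ## Circuit-level corollaries -/

/-- **The ⊕-halving lemma, program form**: a program over `{∧₂, ∨₂, ¬}` with at most `d` NOT
gates, `2^d ≤ k`, whose wire `out` computes the parity fold of a non-constant monotone `f`, is at
least as long as a shortest `{∧₂, ∨₂}`-program for `f`. [cite: Jukna2012, Claim 10.22 (PDF pp. 310–311)] -/
theorem cktSize_of_computes_parityFold {k m d : ℕ} {f : (Fin m → Bool) → Bool} (hf : Monotone f)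
    (hnc : ∃ x y, f x ≠ f y) (hk : 2 ^ d ≤ k) (P : List (Gate (Fin k × Fin m)))
    (out : (Fin k × Fin m) ⊕ ℕ) (hwf : WF P) (hB : ∀ g ∈ P, g.fn ∈ deMorganBasis)
    (hout : OutOK P.length out) (hnegs : negs P ≤ d)
    (hev : ∀ x, wireOf x (vals P x) out = parityFold k m f x) :
    CktSize monotoneBasis (fun (y : Fin m → Bool) (_ : Unit) => f y) P.length :=
  parityFold_induction hf hnc out hout d Finset.univ (fun _ => false) P (by simpa using hk) hwf
    (fun g hg => deMorganBasis_subset_deMorganBasis01 (hB g hg)) rfl hnegs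
    (fun x _ => hev x)

/-- **The ⊕-halving lemma, circuit form** (cell statement `ParityFoldHalving`, ROUND-4 §2.4a):
every De Morgan circuit with at most `d` NOT gates computing the parity fold of `k ≥ 2^d` copies
of a non-constant monotone `f` has at least `circuitSizeOver monotoneBasis f` gates. [cite: Jukna2012, Claim 10.22 (PDF pp. 310–311)] -/
theorem circuitSizeOver_le_of_computes_parityFold {k m d : ℕ} {f : (Fin m → Bool) → Bool}
    (hf : Monotone f) (hnc : ∃ x y, f x ≠ f y) (hk : 2 ^ d ≤ k)
    (C : Circuit (Fin k × Fin m)) (hCB : C.IsOver deMorganBasis) (hneg : C.negationCount ≤ d)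
    (hCf : C.Computes (parityFold k m f)) :
    circuitSizeOver monotoneBasis f ≤ C.size := by
  have h1 : CktSize monotoneBasis (fun (y : Fin m → Bool) (_ : Unit) => f y) C.gates.length :=
    cktSize_of_computes_parityFold hf hnc hk C.gates C.output (wf_gates C) hCB C.wf_output
      (by rw [← circuit_negationCount]; exact hneg)
      (fun x => by rw [← circuit_eval]; exact hCf x)
  obtain ⟨D, hDB, hDs, hDf⟩ := h1.toCircuit
  exact (circuitSizeOver_le_of_computes D hDB (fun y => hDf y)).trans hDs

end Summit.PneNP.PneNP.Theorems.NegLimNearMarkov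

end
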